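import Summits.Ventures.PercRepro.C025ProfileFourCapEBasics
/-!
# (Cap) OF RULE E — `|S| = 4`, and `|S| = 5` without a collinear triple (night-3 g10)
NIGHT3-G10-CAPE-PROOF.md §2. On a rank-`4` set `S` with four points only the six pairs pay, `1/6` each
(`capE_sum_of_card_four`). On a five-point `S` without a rank-`2` triple only the ten pairs pay, and each pays at
most `1/(6(R−3)) ≤ 1/12` (`wE_pair_le_inv`: no point of `S ∖ B` lies on the line of `B`)
(`capE_sum_of_card_five_free`). The counting tool `sum_wE_le_of_pointwise` is shared by every case.
-/
open scoped Matroid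
namespace PercRepro
open Set Finset ThmH
section CapESmall
variable {α : Type} [DecidableEq α] {M : Matroid α} [M.Finite]

/-- The pairs of `S` of rank `2` number at most `C(|S|, 2)`. -/
theorem card_filter_card_two_le (S : Finset α) :
    (((Profile.Rq M 2).filter (fun B => B ⊆ S)).filter (fun B => B.card = 2)).card ≤ Nat.choose S.card 2 := by
  rw [← Finset.card_powersetCard 2 S]
  apply Finset.card_le_card
  intro B hB
  rw [Finset.mem_filter, Finset.mem_filter] at hB
  rw [Finset.mem_powersetCard]
  exact ⟨hB.1.2, hB.2⟩

omit [DecidableEq α] [M.Finite] in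
/-- A rank-`2` set has at least two points. -/
theorem two_le_card_of_eRk_two {B : Finset α} (hB2 : M.eRk (B : Set α) = 2) : 2 ≤ B.card := by
  have h := eRk_le_card (M := M) B
  rw [hB2] at h
  exact_mod_cast h

/-- **The counting tool**: if every pair `B ⊆ S` pays at most `c` and every other rank-`2` subset pays `0`, the total
on `S` is at most `C(|S|, 2)·c`. -/
theorem sum_wE_le_of_pointwise (S : Finset α) (c : ℚ) (hc : 0 ≤ c)
    (hpair : ∀ B ∈ Profile.Rq M 2, B ⊆ S → B.card = 2 → wE M B S ≤ c)
    (hfat : ∀ B ∈ Profile.Rq M 2, B ⊆ S → B.card ≠ 2 → wE M B S = 0) :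
    ∑ B ∈ (Profile.Rq M 2).filter (fun B => B ⊆ S), wE M B S ≤ (Nat.choose S.card 2 : ℚ) * c := by
  calc ∑ B ∈ (Profile.Rq M 2).filter (fun B => B ⊆ S), wE M B S
      ≤ ∑ B ∈ (Profile.Rq M 2).filter (fun B => B ⊆ S), (if B.card = 2 then c else 0) := by
        apply Finset.sum_le_sum
        intro B hB
        rw [Finset.mem_filter] at hB
        split_ifs with h2
        · exact hpair B hB.1 hB.2 h2
        · exact le_of_eq (hfat B hB.1 hB.2 h2)
    _ = ((((Profile.Rq M 2).filter (fun B => B ⊆ S)).filter (fun B => B.card = 2)).card : ℚ) * c := by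
        rw [Finset.sum_ite, Finset.sum_const_zero, add_zero, Finset.sum_const, nsmul_eq_mul]
    _ ≤ (Nat.choose S.card 2 : ℚ) * c := by
        apply mul_le_mul_of_nonneg_right _ hc
        exact_mod_cast card_filter_card_two_le (M := M) S

/-- **(Cap) on a four-point set**: six pairs, `1/6` each. -/
theorem capE_sum_of_card_four {S : Finset α} (hS : S ∈ Shadow.levelSet M 4) (h4 : S.card = 4) :
    ∑ B ∈ (Profile.Rq M 2).filter (fun B => B ⊆ S), wE M B S ≤ 1 := by
  obtain ⟨_, hS4⟩ := Profile.mem_levelSet.1 hS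
  have h := sum_wE_le_of_pointwise (M := M) S (1 / 6) (by norm_num) ?_ ?_
  · rw [h4] at h
    refine h.trans ?_
    have h6 : ((Nat.choose 4 2 : ℕ) : ℚ) = 6 := by norm_num [Nat.choose]
    rw [h6]; norm_num
  · intro B hB hBS hB2
    apply wE_le_sixth_of_card_two _ hB2
    rw [Finset.card_sdiff_of_subset hBS, h4, hB2]
  · intro B hB hBS hB2
    obtain ⟨_, hBr⟩ := Profile.mem_Rq.1 hB
    have hge := two_le_card_of_eRk_two hBr
    have hle := Finset.card_le_card hBS
    apply wE_eq_zero_of_card_sdiff <;> rw [Finset.card_sdiff_of_subset hBS, h4] <;> omega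

/-- **(Cap) on a five-point set without a collinear triple**: ten pairs, at most `1/(6(R−3)) ≤ 1/12` each. -/
theorem capE_sum_of_card_five_free {R : ℕ} (hR : M.eRank = R) (h5R : 5 ≤ R) {S : Finset α}
    (hS : S ∈ Shadow.levelSet M 4) (h5 : S.card = 5)
    (htrip : ∀ T ⊆ S, T.card = 3 → M.eRk (T : Set α) ≠ 2) :
    ∑ B ∈ (Profile.Rq M 2).filter (fun B => B ⊆ S), wE M B S ≤ 1 := by
  obtain ⟨hSg, hS4⟩ := Profile.mem_levelSet.1 hS
  have hR3 : (2 : ℚ) ≤ (R : ℚ) - 3 := by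
    have : (5 : ℚ) ≤ R := by exact_mod_cast h5R
    linarith
  have h := sum_wE_le_of_pointwise (M := M) S (1 / (6 * ((R : ℚ) - 3))) (by positivity) ?_ ?_
  · rw [h5] at h
    refine h.trans ?_
    have h10 : ((Nat.choose 5 2 : ℕ) : ℚ) = 10 := by norm_num [Nat.choose]
    rw [h10, mul_one_div, div_le_one (by positivity)]
    linarith
  · intro B hB hBS hB2
    obtain ⟨hBg, hBr⟩ := Profile.mem_Rq.1 hB
    apply wE_pair_le_inv hR (by omega) hB _ hB2
    · intro u hu hucl
      rw [Finset.mem_sdiff] at hu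
      -- `insert u B ⊆ S` is a rank-`2` triple
      apply htrip (insert u B) (Finset.insert_subset hu.1 hBS) (by rw [Finset.card_insert_of_notMem hu.2, hB2])
      rw [Finset.coe_insert, eRk_insert_eq_of_mem_closure' (by rw [← coe_clF]; exact_mod_cast hucl), hBr]
      rfl
    · rw [Finset.card_sdiff_of_subset hBS, h5, hB2]
  · intro B hB hBS hB2
    obtain ⟨_, hBr⟩ := Profile.mem_Rq.1 hB
    have hge := two_le_card_of_eRk_two hBr
    have hle := Finset.card_le_card hBS
    have h3 : B.card ≠ 3 := fun h3 => htrip B hBS h3 hBr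
    apply wE_eq_zero_of_card_sdiff <;> rw [Finset.card_sdiff_of_subset hBS, h5] <;> omega

end CapESmall
end PercRepro
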